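import Mathlib

/-!
# Rank-one lemma, and the umbilic planes Ω, Ω′ contain no product vectors

Supporting finite-dimensional algebra for the level-statistics (assumption LLA(ν, C₀), eq. (1.5))
analysis of the three-spin block of
[cite: ImbrieJSP2016, eq. (1.1), assumption LLA(ν, C)]  Repair cell b2b-imbrie, LLA.md block Q6.
J. Z. Imbrie, *On many-body localization for quantum spin chains*,
J. Stat. Phys. 163 (2016) 998–1048, arXiv:1403.7837 (Theorem 1.1, Assumption LLA).

* `sq_form_scalar_on_plane`: if the rank-one quadratic form `(a s + b t)²` coincides on a 2-plane
  (orthonormal coordinates `s, t`) with a multiple `c (s² + t²)` of the Euclidean form, then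
  `a = b = c = 0`.  This is the device that expels umbilic 2-planes from every level that carries a
  rank-one parameter direction (a free level position), used in the census of the five- and
  six-level cluster families.
* `omega_vector_not_product`, `omegaPrime_vector_not_product`: a vector of the plane
  Ω = span{Ψ⁻, Φ⁺} ⊂ ℝ² ⊗ ℝ² (coefficients `(β, α, -α, β)` on `|00⟩, |01⟩, |10⟩, |11⟩`), resp. of
  Ω′ = span{Ψ⁺, Φ⁻} (coefficients `(β, α, α, -β)`), is a product vector `a ⊗ b` only if it is zero.

No operator theory or probability is formalised here.
-/

namespace Literature.MathematicalPhysics.QuantumLattice.Imbrie2016.RankOneLemma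

/-- [cite: ImbrieJSP2016, eq. (1.1)] Rank-one lemma in coordinates: `(a s + b t)² = c (s² + t²)` for all real `s, t` forces
`a = b = c = 0`. -/
theorem sq_form_scalar_on_plane {a b c : ℝ}
    (h : ∀ s t : ℝ, (a * s + b * t) ^ 2 = c * (s ^ 2 + t ^ 2)) :
    a = 0 ∧ b = 0 ∧ c = 0 := by
  have h1 : a ^ 2 = c := by have := h 1 0; norm_num at this; linarith
  have h2 : b ^ 2 = c := by have := h 0 1; norm_num at this; linarith
  have h3 : (a + b) ^ 2 = 2 * c := by have := h 1 1; norm_num at this; linarith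
  have hab : a * b = 0 := by nlinarith [h1, h2, h3]
  rcases mul_eq_zero.mp hab with ha | hb
  · have hc : c = 0 := by rw [ha] at h1; simpa using h1.symm
    have hb2 : b ^ 2 = 0 := by rw [hc] at h2; exact h2
    exact ⟨ha, (pow_eq_zero_iff two_ne_zero).mp hb2, hc⟩
  · have hc : c = 0 := by rw [hb] at h2; simpa using h2.symm
    have ha2 : a ^ 2 = 0 := by rw [hc] at h1; exact h1
    exact ⟨(pow_eq_zero_iff two_ne_zero).mp ha2, hb, hc⟩

/-- [cite: ImbrieJSP2016, eq. (1.1)] The same statement read as: a nonzero multiple of the Euclidean form on a 2-plane is never a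
perfect square of a linear functional. -/
theorem sq_form_not_scalar_of_ne_zero {a b c : ℝ} (hc : c ≠ 0) :
    ¬ (∀ s t : ℝ, (a * s + b * t) ^ 2 = c * (s ^ 2 + t ^ 2)) := fun h =>
  hc (sq_form_scalar_on_plane h).2.2

/-- [cite: ImbrieJSP2016, eq. (1.1)] A vector of Ω, i.e. with coefficients `(β, α, -α, β)` on `|00⟩,|01⟩,|10⟩,|11⟩`, is a product
vector `(a₀, a₁) ⊗ (b₀, b₁)` only if `α = β = 0`. -/
theorem omega_vector_not_product {α β a₀ a₁ b₀ b₁ : ℝ}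
    (h00 : a₀ * b₀ = β) (h01 : a₀ * b₁ = α) (h10 : a₁ * b₀ = -α) (h11 : a₁ * b₁ = β) :
    α = 0 ∧ β = 0 := by
  have e1 : (a₀ * b₀) * (a₁ * b₁) = β * β := by rw [h00, h11]
  have e2 : (a₀ * b₁) * (a₁ * b₀) = α * (-α) := by rw [h01, h10]
  have e3 : (a₀ * b₀) * (a₁ * b₁) = (a₀ * b₁) * (a₁ * b₀) := by ring
  have hsum : α ^ 2 + β ^ 2 = 0 := by linear_combination (-1 : ℝ) * e1 + e3 + e2
  have hα2 : α ^ 2 = 0 := by nlinarith [sq_nonneg α, sq_nonneg β]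
  have hβ2 : β ^ 2 = 0 := by nlinarith [sq_nonneg α, sq_nonneg β]
  exact ⟨(pow_eq_zero_iff two_ne_zero).mp hα2, (pow_eq_zero_iff two_ne_zero).mp hβ2⟩

/-- [cite: ImbrieJSP2016, eq. (1.1)] A vector of Ω′, i.e. with coefficients `(β, α, α, -β)`, is a product vector only if
`α = β = 0`. -/
theorem omegaPrime_vector_not_product {α β a₀ a₁ b₀ b₁ : ℝ}
    (h00 : a₀ * b₀ = β) (h01 : a₀ * b₁ = α) (h10 : a₁ * b₀ = α) (h11 : a₁ * b₁ = -β) :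
    α = 0 ∧ β = 0 := by
  have e1 : (a₀ * b₀) * (a₁ * b₁) = β * (-β) := by rw [h00, h11]
  have e2 : (a₀ * b₁) * (a₁ * b₀) = α * α := by rw [h01, h10]
  have e3 : (a₀ * b₀) * (a₁ * b₁) = (a₀ * b₁) * (a₁ * b₀) := by ring
  have hsum : α ^ 2 + β ^ 2 = 0 := by linear_combination e1 - e3 + (-1 : ℝ) * e2
  have hα2 : α ^ 2 = 0 := by nlinarith [sq_nonneg α, sq_nonneg β]
  have hβ2 : β ^ 2 = 0 := by nlinarith [sq_nonneg α, sq_nonneg β]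
  exact ⟨(pow_eq_zero_iff two_ne_zero).mp hα2, (pow_eq_zero_iff two_ne_zero).mp hβ2⟩

end Literature.MathematicalPhysics.QuantumLattice.Imbrie2016.RankOneLemma
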